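import Summits.QuantumFields.BalabanUV.T4Continuum.Support.NE7EnergyRateWPrep
import HarnessLib

/-!
# NE7EnergyRateWGeneric — NODE NE3's RE-TYPED ROOT T-E_w♯ AT d = 4, L = 2 FOR ANY UNITARY GAUGE GROUP `U(card n)`, MODULO ONE GROUP-SPECIFIC INPUT: the class slice-Poincaré inequality of the
# corner-free energy block-Landau slice `𝒯_E` (gen 99's `classSlicePoincare_energyBlockLandau_SU2` at `card n = 2`, gen 105's `…SU3` at `card n = 3`); the k-free strict line of gen 104
# re-derived for any `card n` (`line_of_small_card`)

Cell `pub-balaban`, rung (B)+1 sub-cell t4, lineage `b2b-balaban-t4-ne7-p1`, generation 105 (CRUX PROVER NE7 #1 = OWNER of BINDER row NE7).  Memo `t4/b2b-balaban-t4-ne7-p1-g105/ROAD-G105.md` §8.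
WHY.  `NE7EnergyRateWSU2.ne3EnergyRateWSup_SU2` (this generation, SU(2)) uses `card n = 2` only through (i) gen 99's class slice-Poincaré constant and (ii) the card-2 form of gen 104's k-free line
`line_of_small`; the pair slice decomposition `NE7PairDecompNL0`, the weighted convexity letters, row NE3's (RES♯) and its spike transfer, and the bookkeeping of `NE7EnergyRateWPrep` are stated for any
`n`.  THIS FILE re-runs the assembly with (i) DISPLAYED (`hPclass`, constant `CP₀ ≥ 0`, class radius `≤ ε₁ ≤ 10⁻¹¹`) and (ii) generalised (§1), so that T-E_w♯ at any `U(c)` follows from the class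
Poincaré numerics at `card n = c` alone (SU(3): `NE7EnergyRateWSU3`).
WHAT ([folklore]; 0 def, 0 sorry).  §1 `line_of_small_card` (`c ≥ 1`, `Q ≥ 4`: `(2κ_c + ν_c² + 2304C_S²e^{2C_S} + 112(1+7C_S²) + 1)·ε ≤ (½)∕Q∕4∕c` ⟹ the k-free strict line with `∕c`),
`kfree_coercivity_card`; §2 **`ne3EnergyRateWSup_of_classPoincare`**: `hPclass → ∃ ε₀ > 0, ∀ 0 < ε ≤ ε₀, ∀ b g, 0 ≤ b → b + 10⁸b² ≤ ε → 0 < g → ∃ C s ≥ 0, ∀ N ≥ 1, ∀ dom,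
NE3EnergyRateWSup 4 (sfClass 4 2 N ε) 2 N b g C s dom`.
HONEST FRAMING (page 1): composition of landed kernel theorems of rows NE3 and NE7 and [B7]∕[B8]∕[B11] AS TYPED; nothing of Bałaban's asserted as an axiom; the class Poincaré is a DISPLAYED hypothesis
here (a theorem at `card n = 2, 3`); `n : Type`; constants existential; NOT NE3∕NE7 as spine nodes; NOT infinite volume, NOT mass gap, NOT BetaPertH, NOT Clay (continuum YM on T⁴ ⇐ BetaPertH ∧
nine spine estimates).
-/

set_option autoImplicit false

open scoped BigOperators Matrix Matrix.Norms.L2Operator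
open NormedSpace Finset Set

namespace Summit.QuantumFields.BalabanUV.T4Continuum.NE7EnergyRateWGeneric

open Literature.MathematicalPhysics.QuantumFieldTheory.Balaban1983to89
open B7Prop1Explicit B7Prop2Explicit
open T4AveragingDeficitWall (IsUnitaryCfg IsSkewDir SmallField fineAction vary curl curlSq dirSq)
open T4AveragingDeficitWallBoundary (IsPeriodicCfg periodBox)
open T4ConvexResponse (taylor_lower)
open AveragingDeficitPeriodicCounting (IsPeriodicDir)
open AveragingDeficitDerivWallProof (wallConst wallConst_nonneg)
open AveragingDeficitCoreAxial (coreC_nonneg)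
open AveragingDeficitDualResidual (dualC2 dualC1)
open AveragingDeficitChartCalculus (cavg)
open AveragingDeficitTwoLevelPrep (prop1Radius smallField_cavg)
open AveragingDeficitFermat (isPeriodicCfg_cavg)
open AveragingDeficitMultiLevelPrep (LevelSmall tower)
open AveragingDeficitMultiLevelBridge (cavg_eq_rescale_bavg)
open MinimalActionLevels (perWin levelAction avgIter_rescale_bavg stepWt_pos)
open MinimalActionSandwich (IsMinimiser admissible)
open MinimalActionRate (sfClass Regular)
open NE3HessForm (dAction hess segment_derivData)
open NE3SlicePoincareBudgetLine (CPLine)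
open NE3ClassRadiusFamily (CPLine_nonneg_d4_L2)
open NE3EnergyShapes (IsUnitarySite IsPeriodicSite residualScale residualScale_nonneg dualC1_nonneg dualC2_nonneg)
open NE3EnergyWeightedShapes (energyNormW energyNormW_nonneg)
open NE3EnergyWeightedSupShape (NE3EnergyRateWSup)
open NE3WeightedCoercivityTransfer (energyNormW_sq)
open NE3ProductPathBounds (energyNormW_sub_le)
open NE3EnergyChartLeaves (isUnitaryCfg_cavg_of_regular)
open NE3RightInverseSupLetters (frameC)
open NE3AxialGaugeLadder (smallField_gaugeAct)
open NE7MeanZeroGaugeSliceW (energyBlockLandauW)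
open NE7EnergyBlockLandauClassPoincare (classSlicePoincare_energyBlockLandau_SU2)
open NE7ConvOneStepSU2 (levelSmall_all_d4_L2)
open NE7ConvOneStepWeighted (curlSq_ge_weighted hess_vary_ge_weighted)
open NE7SegmentPlaquetteRadius (smallField_vary_segment_class)
open NE7OneStepLetters (abs_dAction_le_radius_mul)
open NE7ExactCurrent (dAction_add)
open NE7EtaMinimiserGaugeCovariance (levelAction_gaugeAct)
open NE7RepWGaugeOfRoutePi (exp_term_le_of_currency)
open NE7HintUnconditionalSU2 (line_of_small)
open NE7PairDecompNL0 (decomp_of_nl0_pair)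
open NE7EnergySliceSpikeResidual (energyNormW_spike_sq_le spike_tangent_data abs_dAction_le_of_regular_slice)
open BlockAveragePushDirGauge (gaugeDir)
open NE3CornerSpikes (spikeW)
open NE3TangentCovariantTower (framePotW)

open NE7EnergyRateWPrep (wallConst_pos dualC2_pos_d4 residualScale_lower_d4 cavg_admissible_d4 spike_coef_le spike_energy_le two_sided_ineq rate_algebra ratio_le_of_lower)

noncomputable section

/-! ## §1 The k-free strict line and coercivity minorant for any `card n = c` -/

/-- gen 104's `line_of_small` for any `c ≥ 1` in the denominator (`Q ≥ 4`). [folklore] -/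
theorem line_of_small_card {Q c CS νc κc ε : ℝ} (hQ : 4 ≤ Q) (hc : 1 ≤ c) (hCS : 0 < CS) (hε : 0 < ε) (hε1 : ε ≤ 1)
    (hsmall : (2 * κc + νc ^ 2 + 2304 * (CS ^ 2 * Real.exp (2 * CS)) + 112 * (1 + 7 * CS ^ 2) + 1) * ε ≤ (1 / 2) / Q / 4 / c) :
    2 * (κc * ε) < ((((1 / 2 - (νc * ε) ^ 2) / Q - (νc * ε) ^ 2) / 2 - 576 * ((4 : ℕ) : ℝ) * ((CS * ε) ^ 2 * Real.exp (2 * (CS * ε)))) / c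
      - 28 * ((4 : ℕ) : ℝ) * (ε + 7 * (CS * ε) ^ 2)) := by
  have hQ0 : 0 < Q := by linarith
  have hc0 : 0 < c := by linarith
  have hε0 := hε.le
  have hεsq : ε ^ 2 ≤ ε := by nlinarith only [hε0, hε1]
  -- the atoms and their linear bounds in `ε`
  have hX1 : (νc * ε) ^ 2 ≤ νc ^ 2 * ε := by
    rw [mul_pow]; exact mul_le_mul_of_nonneg_left hεsq (sq_nonneg _)
  have hX1_0 : 0 ≤ (νc * ε) ^ 2 := sq_nonneg _
  have hY1 : (νc * ε) ^ 2 / Q ≤ νc ^ 2 * ε := (div_le_self hX1_0 (by linarith)).trans hX1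
  have hY1_0 : 0 ≤ (νc * ε) ^ 2 / Q := by positivity
  have hX3 : (CS * ε) ^ 2 ≤ CS ^ 2 * ε := by
    rw [mul_pow]; exact mul_le_mul_of_nonneg_left hεsq (sq_nonneg _)
  have hexp : Real.exp (2 * (CS * ε)) ≤ Real.exp (2 * CS) := Real.exp_le_exp.2 (by nlinarith only [hCS, hε1, hε0])
  have hX2 : (CS * ε) ^ 2 * Real.exp (2 * (CS * ε)) ≤ CS ^ 2 * Real.exp (2 * CS) * ε := by
    calc (CS * ε) ^ 2 * Real.exp (2 * (CS * ε)) ≤ (CS ^ 2 * ε) * Real.exp (2 * CS) :=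
          mul_le_mul hX3 hexp (Real.exp_pos _).le (by positivity)
      _ = CS ^ 2 * Real.exp (2 * CS) * ε := by ring
  have hT0 : 0 < (1 / 2) / Q := by positivity
  -- the numerator is at least `(½)/Q/2 − (ν_c² + 2304 C_S² e^{2C_S})·ε`
  have hA : (1 / 2) / Q / 2 - (νc ^ 2 + 2304 * (CS ^ 2 * Real.exp (2 * CS))) * ε
      ≤ ((1 / 2 - (νc * ε) ^ 2) / Q - (νc * ε) ^ 2) / 2 - 576 * ((4 : ℕ) : ℝ) * ((CS * ε) ^ 2 * Real.exp (2 * (CS * ε))) := by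
    have hsplit : (1 / 2 - (νc * ε) ^ 2) / Q = (1 / 2) / Q - (νc * ε) ^ 2 / Q := sub_div _ _ _
    rw [hsplit]; push_cast
    nlinarith only [hY1, hY1_0, hX1, hX1_0, hX2, hε0, sq_nonneg νc, mul_nonneg (sq_nonneg CS) (Real.exp_pos (2 * CS)).le]
  -- divide by `c ≥ 1`
  have hB : ((1 / 2) / Q / 2 - (νc ^ 2 + 2304 * (CS ^ 2 * Real.exp (2 * CS))) * ε) / c
      ≤ (((1 / 2 - (νc * ε) ^ 2) / Q - (νc * ε) ^ 2) / 2 - 576 * ((4 : ℕ) : ℝ) * ((CS * ε) ^ 2 * Real.exp (2 * (CS * ε)))) / c :=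
    div_le_div_of_nonneg_right hA hc0.le
  have hB' : (1 / 2) / Q / 2 / c - (νc ^ 2 + 2304 * (CS ^ 2 * Real.exp (2 * CS))) * ε
      ≤ ((1 / 2) / Q / 2 - (νc ^ 2 + 2304 * (CS ^ 2 * Real.exp (2 * CS))) * ε) / c := by
    rw [sub_div]
    have hK0 : 0 ≤ (νc ^ 2 + 2304 * (CS ^ 2 * Real.exp (2 * CS))) * ε := by positivity
    have : (νc ^ 2 + 2304 * (CS ^ 2 * Real.exp (2 * CS))) * ε / c ≤ (νc ^ 2 + 2304 * (CS ^ 2 * Real.exp (2 * CS))) * ε :=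
      div_le_self hK0 hc
    linarith
  -- the last term
  have hC : 28 * ((4 : ℕ) : ℝ) * (ε + 7 * (CS * ε) ^ 2) ≤ 112 * (1 + 7 * CS ^ 2) * ε := by push_cast; nlinarith only [hX3, hε0]
  -- the budget: `(cL − 1)·ε < cL·ε ≤ (½)/Q/4/c = ((½)/Q/2/c)/2`
  have hbud : (2 * κc + νc ^ 2 + 2304 * (CS ^ 2 * Real.exp (2 * CS)) + 112 * (1 + 7 * CS ^ 2)) * ε < (1 / 2) / Q / 2 / c := by
    have h1 : (2 * κc + νc ^ 2 + 2304 * (CS ^ 2 * Real.exp (2 * CS)) + 112 * (1 + 7 * CS ^ 2)) * ε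
        < (2 * κc + νc ^ 2 + 2304 * (CS ^ 2 * Real.exp (2 * CS)) + 112 * (1 + 7 * CS ^ 2) + 1) * ε := by nlinarith only [hε]
    have h2 : (1 / 2) / Q / 4 / c ≤ (1 / 2) / Q / 2 / c := by
      rw [div_le_div_iff_of_pos_right hc0]
      exact div_le_div_of_nonneg_left hT0.le (by norm_num) (by norm_num)
    linarith only [h1, hsmall, h2]
  have hchain := hB'.trans hB
  push_cast at hC hchain hbud ⊢
  linarith only [hchain, hC, hbud]

/-- `NE7EnergyRateWPrep.kfree_coercivity` with any `c > 0` in the denominator. [folklore] -/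
theorem kfree_coercivity_card {c CP CS νc ε ν α M : ℝ} (hc : 0 < c) (hCP : 0 ≤ CP) (hM1 : 1 ≤ M) (hν : 0 ≤ ν) (hνle : ν ≤ νc * ε)
    (hα : 0 ≤ α) (hαM : α * M ≤ CS * ε) :
    ((((1 / 2 - (νc * ε) ^ 2) / (2 * (1 + CP)) - (νc * ε) ^ 2) / 2 - 576 * ((4 : ℕ) : ℝ) * ((CS * ε) ^ 2 * Real.exp (2 * (CS * ε)))) / c
        - 28 * ((4 : ℕ) : ℝ) * (ε + 7 * (CS * ε) ^ 2))
      ≤ ((((1 / 2 - ν ^ 2) / (2 * (1 + CP)) - ν ^ 2) / 2 - 576 * ((4 : ℕ) : ℝ) * (Real.exp α - 1) ^ 2 * M ^ 2) / c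
        - 28 * ((4 : ℕ) : ℝ) * (ε / M ^ 2 + 7 * α ^ 2) * M ^ 2) := by
  have hM0 : 0 < M := by linarith
  have hQ : 0 < 2 * (1 + CP) := by linarith
  have hν2 : ν ^ 2 ≤ (νc * ε) ^ 2 := pow_le_pow_left₀ hν hνle 2
  have hm : (1 / 2 - (νc * ε) ^ 2) / (2 * (1 + CP)) - (νc * ε) ^ 2 ≤ (1 / 2 - ν ^ 2) / (2 * (1 + CP)) - ν ^ 2 := by
    have h1 : (1 / 2 - (νc * ε) ^ 2) / (2 * (1 + CP)) ≤ (1 / 2 - ν ^ 2) / (2 * (1 + CP)) :=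
      div_le_div_of_nonneg_right (by linarith) hQ.le
    linarith
  have hexp : (Real.exp α - 1) ^ 2 * M ^ 2 ≤ (CS * ε) ^ 2 * Real.exp (2 * (CS * ε)) := exp_term_le_of_currency hα hM1 hαM
  have hrad : (ε / M ^ 2 + 7 * α ^ 2) * M ^ 2 ≤ ε + 7 * (CS * ε) ^ 2 := by
    have e : (ε / M ^ 2 + 7 * α ^ 2) * M ^ 2 = ε + 7 * (α * M) ^ 2 := by field_simp
    rw [e]
    have : (α * M) ^ 2 ≤ (CS * ε) ^ 2 := pow_le_pow_left₀ (by positivity) hαM 2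
    linarith
  have h4 : (0 : ℝ) ≤ ((4 : ℕ) : ℝ) := by positivity
  have hA : (((1 / 2 - (νc * ε) ^ 2) / (2 * (1 + CP)) - (νc * ε) ^ 2) / 2 - 576 * ((4 : ℕ) : ℝ) * ((CS * ε) ^ 2 * Real.exp (2 * (CS * ε))))
      ≤ (((1 / 2 - ν ^ 2) / (2 * (1 + CP)) - ν ^ 2) / 2 - 576 * ((4 : ℕ) : ℝ) * (Real.exp α - 1) ^ 2 * M ^ 2) := by nlinarith
  have hB := div_le_div_of_nonneg_right hA hc.le
  have hC : 28 * ((4 : ℕ) : ℝ) * (ε / M ^ 2 + 7 * α ^ 2) * M ^ 2 ≤ 28 * ((4 : ℕ) : ℝ) * (ε + 7 * (CS * ε) ^ 2) := by nlinarith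
  linarith

/-! ## §2 T-E_w♯ modulo the class Poincaré, any `U(card n)` -/

set_option maxHeartbeats 800000 in
/-- **NODE NE3's RE-TYPED ROOT T-E_w♯ AT `d = 4`, `L = 2` FOR ANY `U(card n)`, MODULO THE CLASS SLICE-POINCARÉ INEQUALITY OF `𝒯_E`** (the only gauge-group-specific input; statement and
argument in the file header). [folklore] -/
theorem ne3EnergyRateWSup_of_classPoincare {n : Type} [Fintype n] [DecidableEq n] [Nonempty n] {CP₀ ε₁ : ℝ} (hCP₀0 : 0 ≤ CP₀) (hε₁ : 0 < ε₁)
    (hε₁11 : ε₁ ≤ 1 / 10 ^ 11)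
    (hPclass : ∀ (N : ℕ) [NeZero N], 1 ≤ N → ∀ ε : ℝ, 0 < ε → ε ≤ ε₁ → ∀ (j : ℕ) (W : Site 4 → Fin 4 → (Matrix n n ℂ)ˣ),
      W ∈ sfClass 4 2 N ε (j + 1) →
        NE3SlicePoincareShape.SlicePoincare 2 (j + 1) W (energyBlockLandauW (d := 4) (n := n) 2 N (j + 1) W) CP₀ (periodBox (d := 4) (N * 2 ^ (j + 1)))) :
    ∃ ε₀ : ℝ, 0 < ε₀ ∧ ∀ ε : ℝ, 0 < ε → ε ≤ ε₀ → ∀ b g : ℝ, 0 ≤ b → b + 10 ^ 8 * b ^ 2 ≤ ε → 0 < g →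
      ∃ C s : ℝ, 0 ≤ C ∧ 0 ≤ s ∧ ∀ (N : ℕ) [NeZero N] (dom : Set (Site 4 → Fin 4 → (Matrix n n ℂ)ˣ)),
        NE3EnergyRateWSup 4 (sfClass 4 2 N ε) 2 N b g C s dom := by
  obtain ⟨ε₂, hε₂, CS, hCS, νc, hνc, κc, hκc, hdec⟩ := decomp_of_nl0_pair (n := n)
  -- the k-free coercivity budget (`line_of_small_card`), Poincaré constant `CP = CP₀ + 1`, `c = card n`
  obtain ⟨c, hc⟩ : ∃ c : ℝ, c = (Fintype.card n : ℝ) := ⟨_, rfl⟩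
  have hc1 : 1 ≤ c := by rw [hc]; exact_mod_cast Fintype.card_pos
  have hc0 : 0 < c := by linarith
  obtain ⟨CP, hCP⟩ : ∃ CP : ℝ, CP = CP₀ + 1 := ⟨_, rfl⟩
  have hCP1 : 1 ≤ CP := by rw [hCP]; linarith
  have hCP0 : 0 ≤ CP := by linarith
  obtain ⟨Q, hQ⟩ : ∃ Q : ℝ, Q = 2 * (1 + CP) := ⟨_, rfl⟩
  have hQ4 : 4 ≤ Q := by rw [hQ]; linarith
  have hQ0 : 0 < Q := by linarith
  obtain ⟨cL, hcL⟩ : ∃ cL : ℝ, cL = 2 * κc + νc ^ 2 + 2304 * (CS ^ 2 * Real.exp (2 * CS)) + 112 * (1 + 7 * CS ^ 2) + 1 := ⟨_, rfl⟩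
  have hcL0 : 0 < cL := by rw [hcL]; positivity
  obtain ⟨ε₃, hε₃⟩ : ∃ ε₃ : ℝ, ε₃ = (1 / 2) / Q / 4 / c / cL := ⟨_, rfl⟩
  have hε₃0 : 0 < ε₃ := by rw [hε₃]; positivity
  have hcard : (0 : ℝ) < 1000000000000000000000 * (Fintype.card n : ℝ) := by rw [← hc]; positivity
  refine ⟨min ε₂ (min ε₁ (min (1 / (1000000000000000000000 * (Fintype.card n : ℝ))) (min ε₃ 1))),
    lt_min hε₂ (lt_min hε₁ (lt_min (by positivity) (lt_min hε₃0 one_pos))), ?_⟩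
  intro ε hε hεle b g hb hbq hg
  have hεε₂ : ε ≤ ε₂ := hεle.trans (min_le_left _ _)
  have hε53 : ε ≤ ε₁ := hεle.trans ((min_le_right _ _).trans (min_le_left _ _))
  have hεθ : ε ≤ 1 / (1000000000000000000000 * (Fintype.card n : ℝ)) :=
    hεle.trans ((min_le_right _ _).trans ((min_le_right _ _).trans (min_le_left _ _)))
  have hεε₃ : ε ≤ ε₃ := hεle.trans ((min_le_right _ _).trans ((min_le_right _ _).trans ((min_le_right _ _).trans (min_le_left _ _))))
  have hε1 : ε ≤ 1 := hεle.trans ((min_le_right _ _).trans ((min_le_right _ _).trans ((min_le_right _ _).trans (min_le_right _ _))))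
  have hε11 : ε ≤ 1 / 10 ^ 11 := hε53.trans hε₁11
  have hθline : 1000000000000000000000 * (Fintype.card n : ℝ) * ε ≤ 1 := by
    rw [le_div_iff₀ hcard] at hεθ; linarith
  -- the strict line: `2κ_c ε < cK`, i.e. the gap `γ := cK/2 − κ_c ε > 0`
  have hsmall : cL * ε ≤ (1 / 2) / Q / 4 / c := by
    have h1 : cL * ε ≤ cL * ε₃ := mul_le_mul_of_nonneg_left hεε₃ hcL0.le
    have h2 : cL * ε₃ = (1 / 2) / Q / 4 / c := by rw [hε₃]; field_simp
    linarith only [h1, h2]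
  have hline := line_of_small_card hQ4 hc1 hCS hε hε1 (by rw [← hcL]; exact hsmall)
  obtain ⟨cK, hcK⟩ : ∃ cK : ℝ, cK = ((((1 / 2 - (νc * ε) ^ 2) / Q - (νc * ε) ^ 2) / 2 - 576 * ((4 : ℕ) : ℝ) * ((CS * ε) ^ 2 * Real.exp (2 * (CS * ε)))) / c
      - 28 * ((4 : ℕ) : ℝ) * (ε + 7 * (CS * ε) ^ 2)) := ⟨_, rfl⟩
  rw [← hcK] at hline
  obtain ⟨γ, hγ⟩ : ∃ γ : ℝ, γ = cK / 2 - κc * ε := ⟨_, rfl⟩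
  have hγ0 : 0 < γ := by rw [hγ]; linarith
  -- the constants of the bound
  obtain ⟨C', hC'⟩ : ∃ C' : ℝ, C' = (Real.sqrt (((2 : ℕ) : ℝ) ^ (4 - 2))
            + (Real.sqrt (((2 : ℕ) : ℝ) ^ (4 - 2)) * Real.sqrt (8 * Fintype.card (T4AveragingDeficitWall.Plane 4))
                * (128 * ((4 : ℕ) * ((2 : ℕ) : ℝ) ^ 2))
              + 2 * (2048 * (((4 : ℕ) : ℝ) + 4) ^ 2 * ((2 : ℕ) : ℝ) ^ 2 * Real.sqrt ((4 : ℕ) * ((2 : ℕ) : ℝ) ^ 4))) * b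
            + b ^ 2 * (2 * ((2 : ℕ) : ℝ) ^ (4 - 1) + 2 * (8 * (4 : ℕ) * ((2 : ℕ) : ℝ) ^ 4)) * Real.sqrt ((4 : ℕ) / (g * ((2 : ℕ) : ℝ) ^ (4 + 2)))) := ⟨_, rfl⟩
  have hC'0 : 0 ≤ C' := by rw [hC']; positivity
  obtain ⟨G, hG⟩ : ∃ G : ℝ, G = frameC 4 2 * (CS * ε) := ⟨_, rfl⟩
  have hG0 : 0 ≤ G := by rw [hG]; have := NE7FrameFreeRightInverse.frameC_nonneg 4 2; positivity
  obtain ⟨σ, hσ⟩ : ∃ σ : ℝ, σ = Real.sqrt (4 * (Fintype.card (T4AveragingDeficitWall.Plane 4) : ℝ) + 16) * G := ⟨_, rfl⟩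
  have hσ0 : 0 ≤ σ := by rw [hσ]; positivity
  obtain ⟨w₀, hw₀⟩ : ∃ w₀ : ℝ, w₀ = wallConst 4 2 * dualC2 4 2 * Real.sqrt g := ⟨_, rfl⟩
  have hw₀0 : 0 < w₀ := by rw [hw₀]; exact mul_pos (mul_pos (wallConst_pos 4 2) dualC2_pos_d4) (Real.sqrt_pos.2 hg)
  obtain ⟨Cfin, hCfin⟩ : ∃ Cfin : ℝ, Cfin = C' * (1 + νc * ε) / γ + Real.sqrt (2 * C' * σ / (γ * w₀)) := ⟨_, rfl⟩
  refine ⟨Cfin, CS * ε, by rw [hCfin]; positivity, by positivity, ?_⟩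
  intro N _ dom k hk V _ UA UB hA hB hreg
  have hN : 1 ≤ N := Nat.one_le_iff_ne_zero.mpr (NeZero.ne N)
  obtain ⟨j, rfl⟩ : ∃ j, k = j + 1 := ⟨k - 1, by omega⟩
  have hB' : IsMinimiser 4 (sfClass 4 2 N ε) 2 N (j + 2) V UB := hB
  have hreg' : Regular 4 2 N b g (j + 2) UB := hreg
  -- the competitor `W := cavg 2 U_B` and its class data
  obtain ⟨hbε, hs1, hs2, hWu, hWP, hWx, hWadm⟩ := cavg_admissible_d4 (N := N) j hε hε11 hb hbq hB' hreg'
  have htow : ((tower 2 N (j + 1) : ℕ) : ℤ) = ((N * 2 ^ (j + 1) : ℕ) : ℤ) := by rw [NE3EnergyRateWSupOfSlicePoincare.tower_eq_mul_pow]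
  have hWPt : IsPeriodicCfg (cavg 2 UB) ((tower 2 N (j + 1) : ℕ) : ℤ) := by rw [htow]; exact hWP
  have hM0 : (0 : ℝ) < ((2 : ℕ) : ℝ) ^ (j + 1) := by positivity
  have hM1 : (1 : ℝ) ≤ ((2 : ℕ) : ℝ) ^ (j + 1) := one_le_pow₀ (by norm_num)
  have hx : 0 ≤ ε / (((2 : ℕ) : ℝ) ^ (j + 1)) ^ 2 := by positivity
  -- the pair decomposition in the slice gauge
  obtain ⟨u, X, XT, XN, α, ν, κ, hu, huP, hXs, hXP, hα, hXα, hgauge, hXdec, hXT, hframe, hXN, hν, hNw, hN1, hαM, hνle, hκle⟩ :=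
    hdec N ε hε hεε₂ hθline V j (cavg 2 UB) hWadm UA hA.mem
  have hE0 := energyNormW_nonneg 2 (j + 1) (cavg 2 UB) X (periodBox (d := 4) (N * 2 ^ (j + 1)))
  -- (1) the weighted Poincaré letter on the class (constant `CP₀ ≤ CP`)
  have hP0 := hPclass N hN ε hε hε53 j (cavg 2 UB) ⟨hWu, hWP, hWx⟩
  have hP := NE3SlicePoincareShape.slicePoincare_mono hP0 (show CP₀ ≤ CP by rw [hCP]; linarith)
  have hNw2 : energyNormW 2 (j + 1) (cavg 2 UB) XN (periodBox (d := 4) (N * 2 ^ (j + 1))) ^ 2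
      ≤ ν ^ 2 * energyNormW 2 (j + 1) (cavg 2 UB) X (periodBox (d := 4) (N * 2 ^ (j + 1))) ^ 2 := by
    have h0 := energyNormW_nonneg 2 (j + 1) (cavg 2 UB) XN (periodBox (d := 4) (N * 2 ^ (j + 1)))
    calc _ ≤ (ν * energyNormW 2 (j + 1) (cavg 2 UB) X (periodBox (d := 4) (N * 2 ^ (j + 1)))) ^ 2 := pow_le_pow_left₀ h0 hNw 2
      _ = _ := by ring
  have hm := curlSq_ge_weighted (L := 2) (k := j + 1) hCP0 hP hXdec hXT hNw2
  -- (2) the plaquette radius along the segment, (3) the convexity letter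
  have h1 : SmallField (vary (cavg 2 UB) X 1) (ε / (((2 : ℕ) : ℝ) ^ (j + 1)) ^ 2) := by
    rw [← hgauge]; exact smallField_gaugeAct hu hA.mem.1.2.2
  have hrad : ∀ t ∈ Icc (0 : ℝ) 1, SmallField (vary (cavg 2 UB) X t) (ε / (((2 : ℕ) : ℝ) ^ (j + 1)) ^ 2 + 7 * α ^ 2) := fun t ht =>
    smallField_vary_segment_class hWu hXs hWx h1 hXα ht
  have ha' : 0 ≤ ε / (((2 : ℕ) : ℝ) ^ (j + 1)) ^ 2 + 7 * α ^ 2 := by positivity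
  have hNM : 1 ≤ N * 2 ^ (j + 1) := Nat.mul_pos (by omega) (Nat.pow_pos (by norm_num))
  have hconv : ∀ t ∈ Icc (0 : ℝ) 1,
      ((((1 / 2 - ν ^ 2) / (2 * (1 + CP)) - ν ^ 2) / 2 - 576 * ((4 : ℕ) : ℝ) * (Real.exp α - 1) ^ 2 * (((2 : ℕ) : ℝ) ^ (j + 1)) ^ 2)
            / (Fintype.card n : ℝ)
          - 28 * ((4 : ℕ) : ℝ) * (ε / (((2 : ℕ) : ℝ) ^ (j + 1)) ^ 2 + 7 * α ^ 2) * (((2 : ℕ) : ℝ) ^ (j + 1)) ^ 2)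
          * energyNormW 2 (j + 1) (cavg 2 UB) X (periodBox (d := 4) (N * 2 ^ (j + 1))) ^ 2
        ≤ hess (vary (cavg 2 UB) X t) X X (perWin 4 (N * 2 ^ (j + 1))) := fun t ht =>
    hess_vary_ge_weighted (d := 4) (L := 2) (k := j + 1) (le_refl 1 |>.trans one_le_two) hNM hWu hXs hXP hα hXα hm ht ha' (hrad t ht)
  -- the k-free minorant `cK ≤ c_k`
  have hck : cK ≤ ((((1 / 2 - ν ^ 2) / (2 * (1 + CP)) - ν ^ 2) / 2 - 576 * ((4 : ℕ) : ℝ) * (Real.exp α - 1) ^ 2 * (((2 : ℕ) : ℝ) ^ (j + 1)) ^ 2)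
            / (Fintype.card n : ℝ)
          - 28 * ((4 : ℕ) : ℝ) * (ε / (((2 : ℕ) : ℝ) ^ (j + 1)) ^ 2 + 7 * α ^ 2) * (((2 : ℕ) : ℝ) ^ (j + 1)) ^ 2) := by
    rw [← hc, hcK, hQ]
    exact kfree_coercivity_card hc0 hCP0 hM1 hν hνle hα hαM
  -- (4) Taylor along the segment and (5) minimality of `U_A` against the admissible `W`
  obtain ⟨hd1, hd2⟩ := segment_derivData (cavg 2 UB) X (perWin 4 (N * 2 ^ (j + 1)))
  have htaylor := taylor_lower hd1 hd2 (fun t ht => (mul_le_mul_of_nonneg_right hck (sq_nonneg _)).trans (hconv t ht))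
  rw [T4AveragingDeficitWall.vary_zero] at htaylor
  have hmin : fineAction (vary (cavg 2 UB) X 1) (perWin 4 (N * 2 ^ (j + 1))) ≤ fineAction (cavg 2 UB) (perWin 4 (N * 2 ^ (j + 1))) := by
    have hle := hA.le (cavg 2 UB) hWadm
    rw [← levelAction_gaugeAct 2 N (j + 1) u UA, hgauge] at hle
    unfold levelAction at hle
    have hw : 0 < ((MinimalActionLevels.stepWt 4 2)⁻¹) ^ (j + 1) := pow_pos (inv_pos.mpr (stepWt_pos (d := 4) 2 (by norm_num))) _
    exact le_of_mul_le_mul_left hle hw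
  -- (6) the split of the first variation: the normal part's curl letter
  have hsplit : dAction (cavg 2 UB) X (perWin 4 (N * 2 ^ (j + 1)))
      = dAction (cavg 2 UB) XT (perWin 4 (N * 2 ^ (j + 1))) + dAction (cavg 2 UB) XN (perWin 4 (N * 2 ^ (j + 1))) := by
    conv_lhs => rw [hXdec]
    exact dAction_add _ _ _ _
  have hNpart : |dAction (cavg 2 UB) XN (perWin 4 (N * 2 ^ (j + 1)))| ≤ κ * energyNormW 2 (j + 1) (cavg 2 UB) X (periodBox (d := 4) (N * 2 ^ (j + 1))) ^ 2 :=
    (abs_dAction_le_radius_mul hWu hXN hWx (perWin 4 (N * 2 ^ (j + 1)))).trans hN1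
  -- (7)–(8) (RES♯) on the slice part, with the spike's weighted energy
  have hres := abs_dAction_le_of_regular_slice (n := n) (d := 4) (by norm_num) (le_refl 1 |>.trans one_le_two) hN j hb hbε hg hs2 hB' hreg'
    hWu hWPt hx hs1 hWx hXT
  obtain ⟨-, -, -, hfP, -⟩ := spike_tangent_data (N := N) (le_refl 1 |>.trans one_le_two) j hWu hWPt hx hs1 hWx hXT
  have hS2 := energyNormW_spike_sq_le (d := 4) (le_refl 1 |>.trans one_le_two) hN j hWu hWx hfP hframe
  have hES0 := energyNormW_nonneg 2 (j + 1) (cavg 2 UB) (gaugeDir (cavg 2 UB) (spikeW (2 ^ (j + 1)) (framePotW 2 (j + 1) (cavg 2 UB) XT)))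
      (periodBox (d := 4) (N * 2 ^ (j + 1)))
  have hET := energyNormW_sub_le 2 (j + 1) (cavg 2 UB) X XN (periodBox (d := 4) (N * 2 ^ (j + 1)))
  have hXTeq : XT = X - XN := eq_sub_of_add_eq hXdec.symm
  rw [← hXTeq] at hET
  have hρlow := residualScale_lower_d4 N j (b := b) hg.le
  have hρ0 := residualScale_nonneg 4 2 N b g (j + 1)
  -- ABSTRACT THE ATOMS and do the arithmetic with the pure real lemmas of §3b
  set M : ℝ := ((2 : ℕ) : ℝ) ^ (j + 1) with hM
  set E : ℝ := energyNormW 2 (j + 1) (cavg 2 UB) X (periodBox (d := 4) (N * 2 ^ (j + 1))) with hE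
  set ET : ℝ := energyNormW 2 (j + 1) (cavg 2 UB) XT (periodBox (d := 4) (N * 2 ^ (j + 1))) with hETdef
  set EN : ℝ := energyNormW 2 (j + 1) (cavg 2 UB) XN (periodBox (d := 4) (N * 2 ^ (j + 1))) with hENdef
  set ES : ℝ := energyNormW 2 (j + 1) (cavg 2 UB) (gaugeDir (cavg 2 UB) (spikeW (2 ^ (j + 1)) (framePotW 2 (j + 1) (cavg 2 UB) XT)))
      (periodBox (d := 4) (N * 2 ^ (j + 1))) with hESdef
  set ρ : ℝ := residualScale 4 2 N b g (j + 1) with hρ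
  set P : ℝ := (Fintype.card (T4AveragingDeficitWall.Plane 4) : ℝ) with hPdef
  have hP0' : 0 ≤ P := by rw [hPdef]; positivity
  -- `hres` in the abstract currency: `|dAction W X_T| ≤ C'ρ (ET + ES)`
  have hres' : |dAction (cavg 2 UB) XT (perWin 4 (N * 2 ^ (j + 1)))| ≤ C' * ρ * (ET + ES) := by rw [hC']; exact hres
  have hr0 : 0 ≤ C' * ρ := mul_nonneg hC'0 hρ0
  -- the spike's weighted energy: `ES ≤ σ·N²/M`
  have hESle : ES ≤ σ * ((N : ℝ) ^ 2 / M) := by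
    have h := spike_energy_le hES0 hG0 hM0 hP0' (by rw [hG]; exact hS2)
      (spike_coef_le hM1 hε.le hε1 hP0')
    rw [hσ, hPdef]; simpa only [mul_assoc] using h
  -- (9) the two-sided inequality `γ E² ≤ C'ρ(1+ν_c ε)·E + C'ρ·σ·N²/M`
  have hkey : dAction (cavg 2 UB) X (perWin 4 (N * 2 ^ (j + 1))) + cK * E ^ 2 / 2 ≤ 0 := by linarith only [htaylor, hmin]
  have hETle : ET ≤ (1 + νc * ε) * E := by
    have : EN ≤ νc * ε * E := hNw.trans (mul_le_mul_of_nonneg_right hνle hE0)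
    linarith only [hET, this]
  have hTpart : |dAction (cavg 2 UB) XT (perWin 4 (N * 2 ^ (j + 1)))| ≤ C' * ρ * ((1 + νc * ε) * E + σ * ((N : ℝ) ^ 2 / M)) :=
    hres'.trans (mul_le_mul_of_nonneg_left (by linarith only [hETle, hESle]) hr0)
  have hγE : γ * E ^ 2 ≤ C' * ρ * (1 + νc * ε) * E + C' * ρ * (σ * ((N : ℝ) ^ 2 / M)) := by
    rw [hγ]; exact two_sided_ineq hkey hsplit hNpart hTpart hκle
  -- (10) `N²/M ≤ 2ρ/w₀` and the final bookkeeping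
  have hNM' : (N : ℝ) ^ 2 / M ≤ 2 * ρ / w₀ := ratio_le_of_lower hM0 hw₀0 (by rw [hw₀]; exact hρlow)
  have hfinal : E ≤ Cfin * ρ := by
    rw [hCfin]
    exact rate_algebra hρ0 hγ0 hC'0 (by positivity) hσ0 hw₀0 (by positivity) hNM' hγE
  -- (11) the sup letter: `‖X(b)‖ ≤ α ≤ C_S ε / M = (C_S ε)·2^{−(j+1)}`
  have hsup : ∀ (x : Site 4) (κ' : Fin 4), ‖X x κ'‖ ≤ CS * ε * (((2 : ℕ) : ℝ)⁻¹) ^ (j + 1) := by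
    intro x κ'
    have hαle : α ≤ CS * ε / M := by rw [le_div_iff₀ hM0]; exact hαM
    have e : CS * ε * (((2 : ℕ) : ℝ)⁻¹) ^ (j + 1) = CS * ε / M := by rw [inv_pow, hM]; ring
    rw [e]; exact (hXα x κ').trans hαle
  exact ⟨u, X, hu, huP, hXs, hXP, hgauge, hfinal, hsup⟩


end

end Summit.QuantumFields.BalabanUV.T4Continuum.NE7EnergyRateWGeneric
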